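import Summits.QuantumAdvantage.AdviceFreeQNC0.TensorBlocksFixed
import HarnessLib

/-!
# Cell qa-qnc0 (rung F-Q1, many-blocks corner): the crux of record `TensorMultOneAt` is implied by MULT₁

Planner qa-qnc0-p1 Sketch13: v1 states tensor multiplicativity for ALL block sizes `≥ m₀` with the
consecutive blocks `⌊ik/n⌋` (`TensorMult t β`, crux `TensorMultOne`); v2 states it AT ONE block size `m`
(`TensorMultAt m t β`, crux of record `TensorMultOneAt`).  Since `blockIdx (m·k) k i = ⌊i/m⌋` cuts
`[m·k]` into `k` blocks of size exactly `m`, the v1 form implies the v2 form at every `m ≥ m₀`: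

* `tensorMultAt_of_tensorMult : TensorMult t β → ∃ m₀, ∀ m ≥ m₀, TensorMultAt m t β`;
* `tensorMultOneAt_of_tensorMultOne : TensorMultOne → TensorMultOneAt`.

So every consequence drawn from `TensorMultOneAt` (`t10W_of_tensorMultOneAt`,
`spsRingFailPoly_of_tensorMultOneAt`) is also a consequence of `TensorMultOne`, and refuting
`TensorMultOneAt` refutes `TensorMultOne`.  WHAT THIS IS NOT: neither crux is proved; no converse.
-/

noncomputable section

namespace Summit.QuantumAdvantage.AdviceFreeQNC0

open Finset

/-- **v1 ⇒ v2**: multiplicativity for all block sizes `≥ m₀` gives multiplicativity at each single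
block size `m ≥ m₀` (`n = m·k`, blocks `⌊ik/(mk)⌋ = ⌊i/m⌋` of size `m`; `(β·2^m)^k = β^k·2^{mk}`). -/
theorem tensorMultAt_of_tensorMult {t : ℕ} {β : ℝ} (h : TensorMult t β) :
    ∃ m₀ : ℕ, ∀ m ≥ m₀, TensorMultAt m t β := by
  obtain ⟨m₀, hm₀⟩ := h
  refine ⟨m₀, fun m hm k hk win hwin => ?_⟩
  have hle : m₀ * k ≤ m * k := Nat.mul_le_mul_right k hm
  have := hm₀ (m * k) k hk hle win hwin
  rw [mul_pow, ← pow_mul]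
  exact this

/-- **MULT₁ ⇒ the crux of record**: `TensorMultOne → TensorMultOneAt`. -/
theorem tensorMultOneAt_of_tensorMultOne (h : TensorMultOne) : TensorMultOneAt := by
  obtain ⟨β, hβ, hT⟩ := h
  obtain ⟨m₀, hm₀⟩ := tensorMultAt_of_tensorMult hT
  exact ⟨m₀, β, hβ, hm₀ m₀ le_rfl⟩

end Summit.QuantumAdvantage.AdviceFreeQNC0
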